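import Summits.KontsevichZagierPeriods.KontsevichZagierPeriods.Theorems.HurwitzMicroSectorsHurwitzSectorComplementStubArcSimplexArcs
import Summits.KontsevichZagierPeriods.KontsevichZagierPeriods.Theorems.MultiplicationAccessible.Negative.Core
import Literature.NumberTheory.Transcendental.KZRulesAssociator
import Mathlib.Data.Fin.Tuple.Sort

/-!
# `HurwitzSectorComplement` (stmt-KontsevichZagierPeriods-14341, route HurwitzMicroSectors),
# line `chebyshev-level-deformation`: stub `stub_arcSimplex` (S2a) — chains over cyclotomic arcs

The registered stub `stub_arcSimplex` of the lead skeleton: (i) the increasing chain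
`{tan(πj₀/L) < y_0 < ⋯ < y_{a−1} < tan(πj₁/L)}` with weight `∏ 2/(1+yᵢ²)` (`j₀ < j₁`,
`2j₁ < L`) is KZ-equivalent to the RATIONAL multiple `q · 𝔭_a`,
`q = (4(j₁−j₀))^a / (L^a · a!)`, of the normal form `𝔭_a = [(0,1)^a, ∏ 2/(1+xᵢ²)]`;
(ii) the half-line `[(0,∞), dz/(1+z²)]` is KZ-equivalent to `𝔭₁`.

Two dimension-`n` bookkeeping facts first (sub-namespace `ArcSimplex`):

* `box_sub_factorial_nsmul_chain_mem_relations` (**symmetrisation**): for the box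
  `B = [(c₀,c₁)ⁿ, ∏ 2/(1+yᵢ²)]` and the increasing chain `r` over `(c₀, c₁)` with the same
  integrand, `[B] − n! • [r] ∈ relations`: off the null diagonals `{yᵢ = yⱼ}`
  (`KZ.volume_setOf_apply_eq_apply`) the box is the disjoint union of the `n!` cells
  `{y ∘ σ increasing}` (`Tuple.sort`, `Tuple.unique_monotone`), each ONE coordinate permutation
  (rule (2), `KZ.of_sub_of_reindex_mem_relations`) of `r`; rule (1a) is iterated by
  `KZ.of_sub_sum_of_mem_relations_of_subset`.
* `exists_pow_rep` (**powers of a one-dimensional representation**): for `ρ : KZ.IntegralRep 1`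
  and every `n` there is a representation on `{x | ∀ i, xᵢ ∈ ρ.domain}` with integrand
  `∏ᵢ ρ.integrand(xᵢ)` whose class in `KZ.FormalPeriodRing` is `⟦ρ⟧ⁿ` (iterated Fubini product
  `KZ.IntegralRep.prod`, `KZ.toFormalPeriod_of_mul_of`).

Assembly of (i) (all inside the calculus, no values compared):
* `a! • [chain] ≡ [box over the arc]` (symmetrisation);
* `[box over the arc] = [arc, 2dt/(1+t²)]^a` and `M • 𝔭_a`-type identities in the formal period
  ring (`exists_pow_rep`);
* `L • [arc, dt/(1+t²)] ≡ 4(j₁−j₀) • [(0,1), dt/(1+t²)]` (tiling by the elementary arc of angle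
  `π/(4L)` and Möbius rotations, `ArcSimplex.arc_nsmul_sub_nsmul_mem_relations` of the companion
  file `…StubArcSimplexArcs.lean`);
* scalar bookkeeping in the commutative ring `KZ.FormalPeriodRing`
  (`KZ.IntegralRep.of_constMul_nat_sub_nsmul_mem_relations`) and torsion-freeness of
  `FormalRep ⧸ relations` (`mem_relations_of_nsmul_mem_relations`) to divide by `L^a · a!`.
Part (ii) is `ArcSimplex.halfLine_equivalent` of the companion file.

No definitions (pure proof file).

References: M. Kontsevich, D. Zagier, *Periods* (2001), §1.2 rules (1)–(3), §4.1 (Fubini).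
-/

noncomputable section

open Set MeasureTheory
open scoped BigOperators
open Literature.NumberTheory.Transcendental
open Literature.ModelTheory.ExponentialFields (IsSemialgebraic)
open Summit.KontsevichZagierPeriods.MzvKernelInKZ.Negative

namespace Summit.KontsevichZagierPeriods.Theorems.HurwitzMicroSectorsHurwitzSectorComplement

namespace ArcSimplex

/-- **Symmetrisation of a chain.** For the box `B = [(c₀,c₁)ⁿ, ∏ 2/(1+yᵢ²)]` and the increasing
chain `r` over `(c₀, c₁)` with the same (symmetric) integrand, `[B] − n! • [r] ∈ relations`:
the box is, off the null diagonals, the disjoint union over `σ ∈ 𝔖ₙ` of the cells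
`{y | y ∘ σ ∈ chain}`, each the coordinate permutation `r.reindex σ` of `r`.
[cite: KontsevichZagier2001, §1.2 rules (1)–(2)] -/
theorem box_sub_factorial_nsmul_chain_mem_relations {n : ℕ} {c₀ c₁ : ℝ} (r B : KZ.IntegralRep n)
    (hr : r.domain = {y | (∀ i, c₀ < y i ∧ y i < c₁) ∧ ∀ i i' : Fin n, i < i' → y i < y i'})
    (hri : EqOn r.integrand (fun y => ∏ i, 2 / (1 + y i ^ 2)) r.domain)
    (hB : B.domain = {y | ∀ i, c₀ < y i ∧ y i < c₁})
    (hBi : EqOn B.integrand (fun y => ∏ i, 2 / (1 + y i ^ 2)) B.domain) :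
    KZ.of B - (n.factorial) • KZ.of r ∈ KZ.relations := by
  classical
  -- membership in a cell `r.reindex σ` unfolded
  have hcell : ∀ (σ : Equiv.Perm (Fin n)) (w : Fin n → ℝ), w ∈ (r.reindex σ).domain ↔
      (∀ i, c₀ < w (σ i) ∧ w (σ i) < c₁) ∧ ∀ i i' : Fin n, i < i' → w (σ i) < w (σ i') := by
    intro σ w
    rw [KZ.IntegralRep.reindex_domain, mem_setOf_eq, hr]
    rfl
  have hcellB : ∀ (σ : Equiv.Perm (Fin n)) (w : Fin n → ℝ), w ∈ (r.reindex σ).domain →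
      w ∈ B.domain := by
    intro σ w hw
    rw [hcell] at hw
    rw [hB]
    intro i
    simpa using hw.1 (σ.symm i)
  have h1 : KZ.of B - ∑ σ : Equiv.Perm (Fin n), KZ.of (r.reindex σ) ∈ KZ.relations := by
    refine KZ.of_sub_sum_of_mem_relations_of_subset Finset.univ B (fun σ => r.reindex σ)
      (fun σ _ w hw => hcellB σ w hw) ?_ ?_ ?_
    · intro σ _ w hw
      have hw' : (fun i => w (σ i)) ∈ r.domain := hw
      rw [KZ.IntegralRep.reindex_integrand, hBi (hcellB σ w hw)]
      show r.integrand (fun i => w (σ i)) = ∏ i, 2 / (1 + w i ^ 2)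
      rw [hri hw']
      exact Equiv.prod_comp σ (fun i => 2 / (1 + w i ^ 2))
    · refine measure_mono_null
        (t := ⋃ p : Fin n × Fin n, {w : Fin n → ℝ | p.1 ≠ p.2 ∧ w p.1 = w p.2}) ?_
        (measure_iUnion_null fun p => ?_)
      · rintro w ⟨hwB, hwU⟩
        rw [hB] at hwB
        by_contra hne
        have hinj : Function.Injective w := by
          intro a b hab
          by_contra h
          exact hne (mem_iUnion.mpr ⟨(a, b), h, hab⟩)
        apply hwU
        refine mem_iUnion₂.mpr ⟨Tuple.sort w, Finset.mem_univ _, ?_⟩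
        rw [hcell]
        have hmono : StrictMono (w ∘ Tuple.sort w) :=
          (Tuple.monotone_sort w).strictMono_of_injective (hinj.comp (Tuple.sort w).injective)
        exact ⟨fun i => hwB _, fun i i' h => hmono h⟩
      · rcases eq_or_ne p.1 p.2 with hp | hp
        · have : {w : Fin n → ℝ | p.1 ≠ p.2 ∧ w p.1 = w p.2} = ∅ := by
            ext w; simp [hp]
          rw [this, measure_empty]
        · exact measure_mono_null (fun w hw => hw.2) (KZ.volume_setOf_apply_eq_apply hp)
    · intro σ _ τ _ hστ
      refine Set.disjoint_left.mpr fun w hwσ hwτ => hστ ?_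
      rw [hcell] at hwσ hwτ
      have hsσ : StrictMono (w ∘ σ) := fun i i' h => hwσ.2 i i' h
      have hsτ : StrictMono (w ∘ τ) := fun i i' h => hwτ.2 i i' h
      have heq := Tuple.unique_monotone hsσ.monotone hsτ.monotone
      have hinj : Function.Injective w := hsσ.injective.of_comp_right σ.surjective
      exact Equiv.ext fun i => hinj (congrFun heq i)
  have h2 : ∑ σ : Equiv.Perm (Fin n), KZ.of (r.reindex σ) - (n.factorial) • KZ.of r ∈
      KZ.relations := by
    have : (n.factorial) • KZ.of r = ∑ _σ : Equiv.Perm (Fin n), KZ.of r := by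
      rw [Finset.sum_const, Finset.card_univ, Fintype.card_perm, Fintype.card_fin]
    rw [this, ← Finset.sum_sub_distrib]
    exact sum_mem fun σ _ => by
      simpa using KZ.relations.neg_mem (KZ.of_sub_of_reindex_mem_relations r σ)
  have := KZ.relations.add_mem h1 h2
  rwa [sub_add_sub_cancel] at this

/-- **Powers of a one-dimensional representation.** For `ρ : KZ.IntegralRep 1` and `n : ℕ`
there is a representation `R` on `{x | ∀ i, (xᵢ) ∈ ρ.domain}` with integrand
`x ↦ ∏ᵢ ρ.integrand (xᵢ)` and formal period `⟦R⟧ = ⟦ρ⟧ⁿ` in `KZ.FormalPeriodRing`: the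
iterated Fubini product `(⋯(𝟙.prod ρ).prod ρ⋯).prod ρ`, whose domain and integrand are literally
the displayed ones (`Fin.forall_fin_succ'`, `Fin.prod_univ_castSucc`).
[cite: KontsevichZagier2001, §4.1] -/
theorem exists_pow_rep (ρ : KZ.IntegralRep 1) : ∀ n : ℕ, ∃ R : KZ.IntegralRep n,
    R.domain = {x | ∀ i, (fun _ : Fin 1 => x i) ∈ ρ.domain} ∧
    (R.integrand = fun x => ∏ i, ρ.integrand (fun _ : Fin 1 => x i)) ∧
    KZ.toFormalPeriod (KZ.of R) = KZ.toFormalPeriod (KZ.of ρ) ^ n := by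
  intro n
  induction n with
  | zero =>
    refine ⟨KZ.IntegralRep.unit, ?_, ?_, ?_⟩
    · ext x; simp
    · funext x; simp
    · rw [KZ.toFormalPeriod_of_unit, pow_zero]
  | succ n ih =>
    obtain ⟨R, hRd, hRi, hRT⟩ := ih
    have hfun : ∀ z : Fin (n + 1) → ℝ,
        (fun j : Fin 1 => z (Fin.natAdd n j)) = fun _ => z (Fin.last n) := by
      intro z
      funext j
      rw [Subsingleton.elim j 0]
      congr 1
    refine ⟨R.prod ρ, ?_, ?_, ?_⟩
    · ext z
      simp only [KZ.IntegralRep.prod_domain, KZ.IntegralRep.mem_prodDomain, hRd, mem_setOf_eq,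
        Fin.forall_fin_succ', hfun]
      exact Iff.rfl
    · rw [KZ.IntegralRep.prod_integrand_eq]
      funext z
      rw [KZ.IntegralRep.prodFun_apply, hRi, hfun, Fin.prod_univ_castSucc]
      rfl
    · rw [← KZ.toFormalPeriod_of_mul_of, hRT, pow_succ]

end ArcSimplex

open ArcSimplex

/-- **S2a, chains over cyclotomic arcs.** (i) For `0 ≤ j₀ < j₁`, `2 j₁ < L`, the ordered chain
`{tan(πj₀/L) < y_0 < ⋯ < y_{a−1} < tan(πj₁/L)}` with weight `∏ 2/(1+y_i²)` (in angle coordinates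
the simplex over the arc `(2πj₀/L, 2πj₁/L)`, volume `θ^a/a!` with `θ ∈ πℚ`) is KZ-equivalent to a
RATIONAL multiple of `𝔭_a = [(0,1)^a, ∏ 2/(1+x_i²)]` (symmetrisation `a!·Δ_a ≅ arc^a` modulo null
diagonals and coordinate permutations, Möbius rotations `v ↦ (v−τ)/(1+τv)` of finite order with
algebraic `τ` tiling the arcs, Fubini products, torsion-freeness of `FormalRep ⧸ relations`); the
multiple is `q = (4(j₁−j₀))^a/(L^a·a!)`; (ii) the half-line `[(0,∞), 1/(1+z²)]` is KZ-equivalent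
to `𝔭_1 = [(0,1), 2/(1+x²)]` (cut at `z = 1`, `z ↦ 1/z`). [cite: KontsevichZagier2001, §1.2] -/
theorem stub_arcSimplex :
    (∀ (a j₀ j₁ L : ℕ), j₀ < j₁ → 2 * j₁ < L → ∀ (r : KZ.IntegralRep a),
      r.domain = {y | (∀ i, Real.tan (Real.pi * j₀ / L) < y i ∧ y i < Real.tan (Real.pi * j₁ / L)) ∧
        (∀ i i' : Fin a, i < i' → y i < y i')} →
      Set.EqOn r.integrand (fun y => ∏ i, 2 / (1 + (y i) ^ 2)) r.domain →
      ∃ q : ℚ, ∀ (s : KZ.IntegralRep a), s.domain = {x | ∀ i, x i ∈ Set.Ioo (0:ℝ) 1} →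
        Set.EqOn s.integrand (fun x => (q : ℝ) * ∏ i, 2 / (1 + (x i) ^ 2)) s.domain →
        KZ.Equivalent r s) ∧
    (∀ (r : KZ.IntegralRep 1), r.domain = {z | 0 < z 0} →
      Set.EqOn r.integrand (fun z => 1 / (1 + (z 0) ^ 2)) r.domain →
      ∀ (s : KZ.IntegralRep 1), s.domain = {x | ∀ i, x i ∈ Set.Ioo (0:ℝ) 1} →
        Set.EqOn s.integrand (fun x => ∏ i, 2 / (1 + (x i) ^ 2)) s.domain →
        KZ.Equivalent r s) := by
  refine ⟨fun a j₀ j₁ L hj hL r hr hri => ?_, halfLine_equivalent⟩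
  have hL0 : 0 < L := by omega
  -- the two natural numbers `N = L^a · a!`, `M = (4(j₁−j₀))^a` with `q = M / N`
  set K : ℕ := 4 * (j₁ - j₀) with hK
  set N : ℕ := L ^ a * a.factorial with hN
  set M : ℕ := K ^ a with hM
  have hN0 : N ≠ 0 := mul_ne_zero (pow_ne_zero a hL0.ne') (Nat.factorial_ne_zero a)
  have hNr : (N : ℝ) ≠ 0 := by exact_mod_cast hN0
  refine ⟨(M : ℚ) / (N : ℚ), fun s hs hsi => ?_⟩
  -- one-dimensional representations: the arc `A` and the unit arc `U`, integrand `dt/(1+t²)`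
  have hsaA : IsSemialgebraic ℚ {x : Fin 1 → ℝ | x 0 ∈
      Ioo (Real.tan (Real.pi * j₀ / L)) (Real.tan (Real.pi * j₁ / L))} :=
    (KZ.isSemialgebraic_setOf_const_lt_apply (isAlgebraic_tan_rat_mul_pi j₀ hL0) 0).inter
      (KZ.isSemialgebraic_setOf_apply_lt_const (isAlgebraic_tan_rat_mul_pi j₁ hL0) 0)
  have hsaU : IsSemialgebraic ℚ {x : Fin 1 → ℝ | x 0 ∈ Ioo (0:ℝ) 1} := by
    simpa using sa_Ioo1 0 1
  obtain ⟨A, hAd, hAi⟩ : ∃ A : KZ.IntegralRep 1,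
      A.domain = {x | x 0 ∈ Ioo (Real.tan (Real.pi * j₀ / L)) (Real.tan (Real.pi * j₁ / L))} ∧
      A.integrand = fun x => 1 / (1 + x 0 ^ 2) := ⟨lineRep _ hsaA, rfl, rfl⟩
  obtain ⟨U, hUd, hUi⟩ : ∃ U : KZ.IntegralRep 1, U.domain = {x | x 0 ∈ Ioo (0:ℝ) 1} ∧
      U.integrand = fun x => 1 / (1 + x 0 ^ 2) := ⟨lineRep _ hsaU, rfl, rfl⟩
  -- the weight `2dt/(1+t²)`: `ρ = 2 · A`, `Q = 2 · U = 𝔭₁`; their `a`-th Fubini powers `R`, `P`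
  set ρ := A.constMul ((2 : ℕ) : ℝ) (isAlgebraic_nat 2) with hρ
  set Q := U.constMul ((2 : ℕ) : ℝ) (isAlgebraic_nat 2) with hQ
  obtain ⟨R, hRd, hRi, hRT⟩ := exists_pow_rep ρ a
  obtain ⟨P, hPd, hPi, hPT⟩ := exists_pow_rep Q a
  -- the moves
  have harc : L • KZ.of A - K • KZ.of U ∈ KZ.relations :=
    arc_nsmul_sub_nsmul_mem_relations j₀ j₁ L hj hL A U hAd (fun x _ => congrFun hAi x) hUd
      (fun x _ => congrFun hUi x)
  have hsym : KZ.of R - a.factorial • KZ.of r ∈ KZ.relations := by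
    refine box_sub_factorial_nsmul_chain_mem_relations r R hr hri ?_ ?_
    · rw [hRd]; ext x
      simp only [mem_setOf_eq, hρ, KZ.IntegralRep.domain_constMul, hAd, mem_Ioo]
    · intro x _
      rw [hRi]
      show ∏ i, ρ.integrand (fun _ => x i) = ∏ i, 2 / (1 + x i ^ 2)
      refine Finset.prod_congr rfl fun i _ => ?_
      simp only [hρ, KZ.IntegralRep.integrand_constMul, hAi, Nat.cast_ofNat]
      ring
  have hρA : KZ.of ρ - 2 • KZ.of A ∈ KZ.relations :=
    KZ.IntegralRep.of_constMul_nat_sub_nsmul_mem_relations A 2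
  have hQU : KZ.of Q - 2 • KZ.of U ∈ KZ.relations :=
    KZ.IntegralRep.of_constMul_nat_sub_nsmul_mem_relations U 2
  have hsN : KZ.of (s.constMul (N : ℝ) (isAlgebraic_nat N)) - N • KZ.of s ∈ KZ.relations :=
    KZ.IntegralRep.of_constMul_nat_sub_nsmul_mem_relations s N
  have hPM : KZ.of (P.constMul (M : ℝ) (isAlgebraic_nat M)) - M • KZ.of P ∈ KZ.relations :=
    KZ.IntegralRep.of_constMul_nat_sub_nsmul_mem_relations P M
  -- `N · s` and `M · P` have the same domain `(0,1)^a` and integrand `M ∏ 2/(1+xᵢ²)`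
  have hsP : KZ.of (s.constMul (N : ℝ) (isAlgebraic_nat N)) -
      KZ.of (P.constMul (M : ℝ) (isAlgebraic_nat M)) ∈ KZ.relations := by
    refine KZ.of_sub_of_mem_relations_of_eqOn ?_ fun x hx => ?_
    · show P.domain = s.domain
      rw [hPd, hs]; ext x
      simp only [mem_setOf_eq, hQ, KZ.IntegralRep.domain_constMul, hUd, mem_Ioo]
    · have hx' : x ∈ s.domain := hx
      show (N : ℝ) * s.integrand x = (M : ℝ) * P.integrand x
      rw [hsi hx', hPi]
      simp only [hQ, KZ.IntegralRep.integrand_constMul, hUi, Nat.cast_ofNat]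
      rw [← mul_assoc]
      congr 1
      · push_cast
        field_simp
      · exact Finset.prod_congr rfl fun i _ => by ring
  -- bookkeeping in the formal period ring `Π = FormalRep ⧸ relations`
  have e1 := KZ.toFormalPeriod_eq_zero_of_mem harc
  have e2 := KZ.toFormalPeriod_eq_zero_of_mem hsym
  have e3 := KZ.toFormalPeriod_eq_zero_of_mem hρA
  have e4 := KZ.toFormalPeriod_eq_zero_of_mem hQU
  have e5 := KZ.toFormalPeriod_eq_zero_of_mem hsN
  have e6 := KZ.toFormalPeriod_eq_zero_of_mem hPM
  have e7 := KZ.toFormalPeriod_eq_zero_of_mem hsP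
  simp only [map_sub, map_nsmul, nsmul_eq_mul, sub_eq_zero] at e1 e2 e3 e4 e5 e6 e7
  have key : KZ.toFormalPeriod (N • (KZ.of r - KZ.of s)) = 0 := by
    rw [map_nsmul, map_sub, nsmul_eq_mul, mul_sub, sub_eq_zero]
    calc (N : KZ.FormalPeriodRing) * KZ.toFormalPeriod (KZ.of r)
        = (L : KZ.FormalPeriodRing) ^ a * (a.factorial * KZ.toFormalPeriod (KZ.of r)) := by
          rw [hN]; push_cast; ring
      _ = (L : KZ.FormalPeriodRing) ^ a * KZ.toFormalPeriod (KZ.of ρ) ^ a := by rw [← e2, hRT]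
      _ = (2 : KZ.FormalPeriodRing) ^ a * (L * KZ.toFormalPeriod (KZ.of A)) ^ a := by
          rw [e3]; push_cast; ring
      _ = (2 : KZ.FormalPeriodRing) ^ a * (K * KZ.toFormalPeriod (KZ.of U)) ^ a := by rw [e1]
      _ = (M : KZ.FormalPeriodRing) * KZ.toFormalPeriod (KZ.of Q) ^ a := by
          rw [e4, hM]; push_cast; ring
      _ = (N : KZ.FormalPeriodRing) * KZ.toFormalPeriod (KZ.of s) := by
          rw [← hPT, ← e6, ← e7, e5]
  exact
    Summit.KontsevichZagierPeriods.MultiplicationAccessible.Negative.mem_relations_of_nsmul_mem_relations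
      hN0 (KZ.toFormalPeriod_eq_zero_iff.mp key)

end Summit.KontsevichZagierPeriods.Theorems.HurwitzMicroSectorsHurwitzSectorComplement
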